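import Literature.Computability.FineGrained.Sweep1EqualityRank
import Literature.Computability.FineGrained.Sweep1OVMainLoop
import HarnessLib

/-!
# Williams' Orthogonal Vectors algorithm: what the program computes

Bridge between the representation theory of `Literature.Computability.FineGrained.Sweep1EqualityRank`
(R. Williams, FOCS 2024 / ECCC TR24-142, Thms. 2, 8, 10) and the word-RAM program `OVEq.prog` of
`…Sweep1OVProgram` / `…Sweep1OVMainLoop` (Thms. 10 and 3): the compile-time tables
`EqRep.tablesOf R` of a representation (row/column tables on block codes `EqRep.codeOfVec`, coefficient
magnitudes and sign bits), their well-formedness (`EqRep.tablesOf_WF`), and the identification of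
the program's closed forms with the Kronecker power of `R`: block codes (`codeA_ofRep`), base-`r`
digits of the term number as the multi-index `q ∈ [r]^K` (`digit_ofRep`, via `finFunctionFinEquiv`),
keys (`keyA_ofRep`/`keyB_ofRep` = `EqRep.key`), the signed magnitude (`signedMag_ofRep_K` =
`EqRep.coefProd`), the count (`cnt_ofRep` = number of equal key pairs), whence
**`Spos_sub_Sneg_ofRep`**: `S⁺ - S⁻ = EqRep.pairSum R K A B` (the paper's `S' = Σ_k α_k T_k`), and
**`outBit_ofRep`**: for a positive representation the output bit is `[the instance has an
orthogonal pair]` (Thm. 10: `S' > 0` iff there is a satisfying pair).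

## References

* R. Williams, *The Orthogonal Vectors Conjecture and Non-Uniform Circuit Lower Bounds*, FOCS 2024;
  ECCC TR24-142, §3, Thms. 8 and 10.
-/

namespace Literature.Computability.FineGrained

open Cryptography Cryptography.WordRAM Complexity

/-! ## Bridge: the tables of a representation, and what the program computes -/

namespace EqRep

open Finset OVEq

variable {k r : ℕ}

/-- The code `Σ_t [v t] 2^t` of a `k`-bit vector (the block codes of the program). [folklore] -/
def codeOfVec (v : Fin k → Bool) : ℕ :=
  (finFunctionFinEquiv (fun t => if v t then (1 : Fin 2) else 0) : Fin (2 ^ k)).val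

/-- Codes are below `2^k`. [folklore] -/
theorem codeOfVec_lt (v : Fin k → Bool) : codeOfVec v < 2 ^ k := Fin.is_lt _

/-- The code as a sum of bits. [folklore] -/
theorem codeOfVec_eq (v : Fin k → Bool) : codeOfVec v = ∑ t : Fin k, (v t).toNat * 2 ^ (t : ℕ) := by
  unfold codeOfVec; rw [finFunctionFinEquiv_apply]
  refine Finset.sum_congr rfl fun t _ => ?_
  cases v t <;> simp

/-- Decoding a code. [folklore] -/
def vecOf (k c : ℕ) : Fin k → Bool := fun t =>
  finFunctionFinEquiv.symm (⟨c % 2 ^ k, Nat.mod_lt _ (Nat.two_pow_pos k)⟩ : Fin (2 ^ k)) t = 1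

/-- Decoding inverts coding. [folklore] -/
theorem vecOf_codeOfVec (v : Fin k → Bool) : vecOf k (codeOfVec v) = v := by
  funext t
  unfold vecOf
  have : (⟨codeOfVec v % 2 ^ k, Nat.mod_lt _ (Nat.two_pow_pos k)⟩ : Fin (2 ^ k)) =
      finFunctionFinEquiv (fun t => if v t then (1 : Fin 2) else 0) := by
    apply Fin.ext; simp only [Nat.mod_eq_of_lt (codeOfVec_lt v)]; rfl
  rw [this, Equiv.symm_apply_apply]
  cases v t <;> simp

/-- **The compile-time tables of a representation**: row/column tables on block codes,
coefficient magnitudes and sign bits. [folklore] -/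
def tablesOf (R : EqRep k r) : Tables where
  k := k
  r := r
  Bd := R.bound
  U ℓ c := if h : ℓ < r then R.left ⟨ℓ, h⟩ (vecOf k c) else 0
  V ℓ c := if h : ℓ < r then R.right ⟨ℓ, h⟩ (vecOf k c) else 0
  cmag ℓ := if h : ℓ < r then (R.coef ⟨ℓ, h⟩).natAbs else 0
  csgn ℓ := if h : ℓ < r then (if R.coef ⟨ℓ, h⟩ < 0 then 1 else 0) else 0
  cmax := Finset.univ.sup fun ℓ : Fin r => (R.coef ℓ).natAbs

/-- The tables of a representation with `k ≥ 1` and `bound ≥ 1` are well formed. [folklore] -/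
theorem tablesOf_WF (R : EqRep k r) (hk : 1 ≤ k) (hb : 1 ≤ R.bound) : R.tablesOf.WF where
  k_pos := hk
  U_lt ℓ c := by
    show (if h : ℓ < r then R.left ⟨ℓ, h⟩ (vecOf k c) else 0) < R.bound
    split_ifs with h
    · exact R.left_lt _ _
    · exact hb
  V_lt ℓ c := by
    show (if h : ℓ < r then R.right ⟨ℓ, h⟩ (vecOf k c) else 0) < R.bound
    split_ifs with h
    · exact R.right_lt _ _
    · exact hb
  csgn_le ℓ := by
    show (if h : ℓ < r then (if R.coef ⟨ℓ, h⟩ < 0 then 1 else 0) else 0) ≤ 1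
    split_ifs <;> omega
  cmag_le ℓ := by
    show (if h : ℓ < r then (R.coef ⟨ℓ, h⟩).natAbs else 0) ≤
      Finset.univ.sup fun ℓ : Fin r => (R.coef ℓ).natAbs
    split_ifs with h
    · exact Finset.le_sup (f := fun ℓ : Fin r => (R.coef ℓ).natAbs) (Finset.mem_univ (⟨ℓ, h⟩ : Fin r))
    · exact Nat.zero_le _

/-- A positive representation has a term, hence `bound ≥ 1` (and `r ≥ 1`). [folklore] -/
theorem IsPosDisj.one_le_bound {R : EqRep k r} (hR : R.IsPosDisj) : 1 ≤ R.bound := by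
  have h := (hR.pos_iff (fun _ => false) (fun _ => false)).2 (fun i hi => by simp at hi)
  unfold eval at h
  rcases Nat.eq_zero_or_pos r with hr | hr
  · subst hr; simp at h
  · have := R.left_lt ⟨0, hr⟩ fun _ => false; omega

end EqRep

namespace OVEq.Params

open Finset

variable {k r : ℕ} (R : EqRep k r) (I : OVInstance)

/-- The run parameters of the program of `R` on the instance `I`. [folklore] -/
def ofRep : Params := ⟨R.tablesOf, I⟩

/-- Bits of the program are the entries of the instance. [folklore] -/
theorem bitA_ofRep (i : Fin I.n) {t : ℕ} (ht : t < I.d) :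
    (ofRep R I).bitA i t = (I.A i ⟨t, ht⟩).toNat := by
  show (if h : (i : ℕ) < I.n ∧ t < I.d then (I.A ⟨i, h.1⟩ ⟨t, h.2⟩).toNat else 0) = _
  rw [dif_pos ⟨i.2, ht⟩]

/-- Bits of the program are the entries of the instance. [folklore] -/
theorem bitB_ofRep (j : Fin I.n) {t : ℕ} (ht : t < I.d) :
    (ofRep R I).bitB j t = (I.B j ⟨t, ht⟩).toNat := by
  show (if h : (j : ℕ) < I.n ∧ t < I.d then (I.B ⟨j, h.1⟩ ⟨t, h.2⟩).toNat else 0) = _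
  rw [dif_pos ⟨j.2, ht⟩]

/-- A block code of a row is the code of the zero-padded block (reindexing `t' = mb k + t`).
[folklore] -/
theorem partCode_eq_codeOfVec (hk : 0 < k) {d : ℕ} (a : Fin d → Bool) (bit : ℕ → ℕ)
    (hbit : ∀ t (ht : t < d), bit t = (a ⟨t, ht⟩).toNat) (mb : ℕ) :
    partCode bit k d mb = EqRep.codeOfVec (blockOf k a mb) := by
  rw [EqRep.codeOfVec_eq]
  unfold partCode
  -- restrict the right-hand side to the coordinates inside the vector
  have hrhs : ∑ t : Fin k, (blockOf k a mb t).toNat * 2 ^ (t : ℕ) =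
      ∑ t ∈ (univ : Finset (Fin k)).filter (fun t : Fin k => mb * k + (t : ℕ) < d),
        (blockOf k a mb t).toNat * 2 ^ (t : ℕ) := by
    rw [Finset.sum_filter]
    refine Finset.sum_congr rfl fun t _ => ?_
    by_cases h : mb * k + (t : ℕ) < d
    · rw [if_pos h]
    · rw [if_neg h]; simp [blockOf, h]
  rw [hrhs]
  have hdec : ∀ t', t' / k = mb → mb * k + t' % k = t' := fun t' ht' => by
    have := Nat.div_add_mod t' k; rw [ht', Nat.mul_comm] at this; exact this
  refine Finset.sum_nbij' (fun t' => (⟨t' % k, Nat.mod_lt _ hk⟩ : Fin k)) (fun t : Fin k => mb * k + (t : ℕ))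
    ?_ ?_ ?_ ?_ ?_
  · intro t' ht'
    rw [mem_filter, mem_range] at ht'
    rw [mem_filter]
    exact ⟨mem_univ _, by rw [hdec t' ht'.2]; exact ht'.1⟩
  · intro t ht
    rw [mem_filter] at ht
    rw [mem_filter, mem_range]
    refine ⟨ht.2, ?_⟩
    rw [Nat.mul_comm, Nat.mul_add_div hk, Nat.div_eq_of_lt t.2, Nat.add_zero]
  · intro t' ht'
    rw [mem_filter, mem_range] at ht'
    exact hdec t' ht'.2
  · intro t _
    apply Fin.ext
    show (mb * k + (t : ℕ)) % k = t
    rw [Nat.mul_comm, Nat.mul_add_mod, Nat.mod_eq_of_lt t.2]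
  · intro t' ht'
    rw [mem_filter, mem_range] at ht'
    have hlt : mb * k + t' % k < d := by rw [hdec t' ht'.2]; exact ht'.1
    have heq : (⟨mb * k + t' % k, hlt⟩ : Fin d) = ⟨t', ht'.1⟩ := Fin.ext (hdec t' ht'.2)
    simp only [blockOf, hlt, dif_pos]
    rw [hbit t' ht'.1, heq]

/-- Block codes of the program are the codes of the zero-padded blocks. [folklore] -/
theorem codeA_ofRep (hk : 0 < k) (i : Fin I.n) (mb : ℕ) :
    (ofRep R I).codeA i mb = EqRep.codeOfVec (blockOf k (I.A i) mb) :=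
  partCode_eq_codeOfVec hk (I.A i) _ (fun _ ht => bitA_ofRep R I i ht) mb

/-- Block codes of the program are the codes of the zero-padded blocks. [folklore] -/
theorem codeB_ofRep (hk : 0 < k) (j : Fin I.n) (mb : ℕ) :
    (ofRep R I).codeB j mb = EqRep.codeOfVec (blockOf k (I.B j) mb) :=
  partCode_eq_codeOfVec hk (I.B j) _ (fun _ ht => bitB_ofRep R I j ht) mb

/-! ### Digits, keys and coefficients of a term -/

variable (hk : 0 < k)

/-- The block length of the run. [folklore] -/
@[simp] theorem ofRep_k : (ofRep R I).tb.k = k := rfl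
/-- The number of terms of the run. [folklore] -/
@[simp] theorem ofRep_r : (ofRep R I).tb.r = r := rfl
/-- The key base of the run. [folklore] -/
@[simp] theorem ofRep_Bd : (ofRep R I).tb.Bd = R.bound := rfl
/-- The instance size of the run. [folklore] -/
@[simp] theorem ofRep_n : (ofRep R I).n = I.n := rfl
/-- The dimension of the run. [folklore] -/
@[simp] theorem ofRep_d : (ofRep R I).d = I.d := rfl

/-- The multi-index `q' ∈ [r]^K` of the term with number `q < r^K`. [folklore] -/
def termIdx {K : ℕ} (q : Fin (r ^ K)) : Fin K → Fin r := finFunctionFinEquiv.symm q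

/-- The base-`r` digits of `q` are the components of its multi-index. [folklore] -/
theorem digit_ofRep {K : ℕ} (q : Fin (r ^ K)) (mb : Fin K) :
    (ofRep R I).digit q mb = (termIdx q mb : ℕ) := by
  unfold digit termIdx; rw [finFunctionFinEquiv_symm_apply_val]; rfl

/-- The row table at a digit and a block code is the row value of the representation.
[folklore] -/
theorem U_ofRep (ℓ : Fin r) (v : Fin k → Bool) :
    (ofRep R I).tb.U ℓ (EqRep.codeOfVec v) = R.left ℓ v := by
  show (if h : (ℓ : ℕ) < r then R.left ⟨ℓ, h⟩ (EqRep.vecOf k (EqRep.codeOfVec v)) else 0) = _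
  rw [dif_pos ℓ.2, EqRep.vecOf_codeOfVec]

/-- The column table at a digit and a block code is the column value of the representation.
[folklore] -/
theorem V_ofRep (ℓ : Fin r) (v : Fin k → Bool) :
    (ofRep R I).tb.V ℓ (EqRep.codeOfVec v) = R.right ℓ v := by
  show (if h : (ℓ : ℕ) < r then R.right ⟨ℓ, h⟩ (EqRep.vecOf k (EqRep.codeOfVec v)) else 0) = _
  rw [dif_pos ℓ.2, EqRep.vecOf_codeOfVec]

include hk in
/-- **The program's keys are the packed defining vectors of the Kronecker power.** [folklore] -/
theorem keyA_ofRep {K : ℕ} (q : Fin (r ^ K)) (i : Fin I.n) :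
    (ofRep R I).keyA q i K = R.key R.left (termIdx q) (EqRep.blocks k K (I.A i)) := by
  unfold keyA EqRep.key
  rw [Finset.sum_range]
  refine Finset.sum_congr rfl fun mb _ => ?_
  rw [digit_ofRep, codeA_ofRep R I hk, U_ofRep]; rfl

include hk in
/-- The program's keys of the second list. [folklore] -/
theorem keyB_ofRep {K : ℕ} (q : Fin (r ^ K)) (j : Fin I.n) :
    (ofRep R I).keyB q j K = R.key R.right (termIdx q) (EqRep.blocks k K (I.B j)) := by
  unfold keyB EqRep.key
  rw [Finset.sum_range]
  refine Finset.sum_congr rfl fun mb _ => ?_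
  rw [digit_ofRep, codeB_ofRep R I hk, V_ofRep]; rfl

/-- The signed magnitude of the program. [folklore] -/
def signedMag (g : Params) (q M : ℕ) : ℤ := if g.sgn q M = 0 then (g.mag q M : ℤ) else -(g.mag q M : ℤ)

/-- **The program's magnitude and sign bit give the coefficient of the Kronecker power.**
[folklore] -/
theorem signedMag_ofRep {K : ℕ} (q : Fin (r ^ K)) {M : ℕ} (hM : M ≤ K) :
    signedMag (ofRep R I) q M =
      ∏ mb ∈ Finset.range M, if h : mb < K then R.coef (termIdx q ⟨mb, h⟩) else 1 := by
  induction M with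
  | zero => simp [signedMag, sgn, mag]
  | succ M ih =>
    have hM' : M < K := hM
    rw [Finset.prod_range_succ, ← ih hM'.le, dif_pos hM']
    have hWF : ∀ ℓ, (ofRep R I).tb.csgn ℓ ≤ 1 := fun ℓ => by
      show (if h : ℓ < r then (if R.coef ⟨ℓ, h⟩ < 0 then 1 else 0) else 0) ≤ 1
      split_ifs <;> omega
    have hsg : (ofRep R I).sgn q (M + 1) = (ofRep R I).sgn q M ^^^ (ofRep R I).tb.csgn ((ofRep R I).digit q M) := by
      rw [xor_bits (sgn_le _ q M) (hWF _)]
      unfold sgn; rw [Finset.sum_range_succ, Nat.mod_add_mod]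
    have hdig : (ofRep R I).digit q M = (termIdx q ⟨M, hM'⟩ : ℕ) := digit_ofRep R I q ⟨M, hM'⟩
    set c := R.coef (termIdx q ⟨M, hM'⟩) with hc
    have hcs : (ofRep R I).tb.csgn ((ofRep R I).digit q M) = if c < 0 then 1 else 0 := by
      rw [hdig]
      show (if h : ((termIdx q ⟨M, hM'⟩ : Fin r) : ℕ) < r then
        (if R.coef ⟨_, h⟩ < 0 then 1 else 0) else 0) = _
      rw [dif_pos (Fin.is_lt _)]
    have hcm : (ofRep R I).tb.cmag ((ofRep R I).digit q M) = c.natAbs := by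
      rw [hdig]
      show (if h : ((termIdx q ⟨M, hM'⟩ : Fin r) : ℕ) < r then (R.coef ⟨_, h⟩).natAbs else 0) = _
      rw [dif_pos (Fin.is_lt _)]
    have hs1 := sgn_le (ofRep R I) q M
    unfold signedMag
    rw [hsg, mag_succ, hcs, hcm]
    push_cast
    by_cases hneg : c < 0
    · rw [if_pos hneg, abs_of_neg hneg]
      rcases Nat.le_one_iff_eq_zero_or_eq_one.1 hs1 with h0 | h1
      · rw [h0]; simp
      · rw [h1]; simp
    · rw [if_neg hneg, abs_of_nonneg (le_of_not_gt hneg)]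
      rcases Nat.le_one_iff_eq_zero_or_eq_one.1 hs1 with h0 | h1
      · rw [h0]; simp
      · rw [h1]; simp

/-- At `M = K` the signed magnitude is the coefficient `∏ α_{q_mb}`. [folklore] -/
theorem signedMag_ofRep_K {K : ℕ} (q : Fin (r ^ K)) :
    signedMag (ofRep R I) q K = R.coefProd (termIdx q) := by
  rw [signedMag_ofRep R I q le_rfl, EqRep.coefProd, ← Fin.prod_univ_eq_prod_range]
  refine Finset.prod_congr rfl fun mb _ => ?_
  rw [dif_pos mb.2]

/-! ### The count and the pair sum -/

/-- A filtered count over `range n` is the filtered count over `Fin n`. [folklore] -/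
theorem card_filter_range_eq {n : ℕ} (Q : ℕ → Prop) [DecidablePred Q] :
    ((Finset.range n).filter Q).card = ((univ : Finset (Fin n)).filter fun i : Fin n => Q (i : ℕ)).card := by
  rw [Finset.card_filter, Finset.card_filter, Finset.sum_range]

include hk in
/-- **The program's count is the number of equal key pairs of the Kronecker power.** [folklore] -/
theorem cnt_ofRep (q : Fin (r ^ (ofRep R I).K)) :
    (ofRep R I).cnt q I.n = ((univ ×ˢ univ).filter fun p : Fin I.n × Fin I.n =>
      R.key R.left (termIdx q) (EqRep.blocks k (ofRep R I).K (I.A p.1)) =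
        R.key R.right (termIdx q) (EqRep.blocks k (ofRep R I).K (I.B p.2))).card := by
  have h1 : ((univ ×ˢ univ).filter fun p : Fin I.n × Fin I.n =>
      R.key R.left (termIdx q) (EqRep.blocks k (ofRep R I).K (I.A p.1)) =
        R.key R.right (termIdx q) (EqRep.blocks k (ofRep R I).K (I.B p.2))).card =
      ∑ i : Fin I.n, ∑ j : Fin I.n,
        if R.key R.left (termIdx q) (EqRep.blocks k (ofRep R I).K (I.A i)) =
          R.key R.right (termIdx q) (EqRep.blocks k (ofRep R I).K (I.B j)) then 1 else 0 := by
    rw [Finset.card_filter, ← Finset.sum_product' (f := fun (i j : Fin I.n) =>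
      if R.key R.left (termIdx q) (EqRep.blocks k (ofRep R I).K (I.A i)) =
          R.key R.right (termIdx q) (EqRep.blocks k (ofRep R I).K (I.B j)) then 1 else 0)]
  rw [h1, Finset.sum_comm]
  unfold cnt hcount
  rw [ofRep_n, Finset.sum_range]
  refine Finset.sum_congr rfl fun j _ => ?_
  rw [card_filter_range_eq, Finset.card_filter]
  refine Finset.sum_congr rfl fun i _ => ?_
  rw [keyA_ofRep R I hk q i, keyB_ofRep R I hk q j]

/-- `S⁺ - S⁻` as the signed sum over the terms. [folklore] -/
theorem Spos_sub_Sneg_eq_sum (g : Params) (Q : ℕ) :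
    ((g.Spos Q : ℕ) : ℤ) - (g.Sneg Q : ℕ) = ∑ q ∈ Finset.range Q, signedMag g q g.K * g.cnt q g.n := by
  induction Q with
  | zero => simp [Spos, Sneg]
  | succ Q ih =>
    rw [Spos_succ, Sneg_succ, Finset.sum_range_succ, ← ih]
    unfold signedMag
    by_cases h : g.sgn Q g.K = 0
    · rw [if_pos h, if_neg (by rw [h]; decide), if_pos h]; push_cast; ring
    · rw [if_neg h, if_pos h, if_neg h]; push_cast; ring

include hk in
/-- **What the program computes**: `S⁺ - S⁻` is the pair sum of the Kronecker power of the
representation over the instance (Williams, ECCC TR24-142, proof of Thm. 10: `S' = Σ_k α_k T_k`).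
[folklore] -/
theorem Spos_sub_Sneg_ofRep :
    (((ofRep R I).Spos (ofRep R I).RK : ℕ) : ℤ) - ((ofRep R I).Sneg (ofRep R I).RK : ℕ) =
      R.pairSum (ofRep R I).K I.A I.B := by
  rw [Spos_sub_Sneg_eq_sum, R.pairSum_eq_count, RK, ofRep_r, Finset.sum_range,
    ← (finFunctionFinEquiv (m := r) (n := (ofRep R I).K)).symm.sum_comp]
  refine Finset.sum_congr rfl fun q _ => ?_
  rw [signedMag_ofRep_K, ofRep_n, cnt_ofRep R I hk q]
  rfl

include hk in
/-- **The output bit is the answer**: for a positive representation, the program outputs `1` iff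
the instance has an orthogonal pair. [folklore] -/
theorem outBit_ofRep (hR : R.IsPosDisj) :
    (ofRep R I).outBit = if I.HasOrthogonalPair then 1 else 0 := by
  have hKk : I.d ≤ k * (ofRep R I).K := by
    show I.d ≤ k * ((I.d + (k - 1)) / k)
    have h1 := Nat.div_add_mod (I.d + (k - 1)) k
    have h2 := Nat.mod_lt (I.d + (k - 1)) hk
    omega
  have hpos := R.pairSum_pos_iff ((ofRep R I).K) hR hk hKk I.A I.B
  have hnn := R.pairSum_nonneg ((ofRep R I).K) hR I.A I.B
  have hS := Spos_sub_Sneg_ofRep R I hk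
  unfold outBit OVInstance.HasOrthogonalPair
  by_cases h : (ofRep R I).Spos (ofRep R I).RK = (ofRep R I).Sneg (ofRep R I).RK
  · rw [if_pos h, if_neg]
    rw [← hpos]; rw [h, sub_self] at hS; rw [← hS]; exact lt_irrefl _
  · rw [if_neg h, if_pos]
    rw [← hpos]
    rcases hnn.lt_or_eq with hlt | heq
    · exact hlt
    · exfalso; apply h; rw [← heq] at hS; omega

end OVEq.Params


end Literature.Computability.FineGrained
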